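import Summits.CriticalPhenomena.PercolationContinuityZ3.Theorems.PercNearOneGluingNoHeavyLowerTailSahiGridPatternCaterpillar
import Summits.CriticalPhenomena.PercolationContinuityZ3.Theorems.PercNearOneGluingNoHeavyLowerTailSahiGridPatternDiagCertLiteralTwoOr

/-!
# `NoHeavyLowerTail` (crux stmt-CriticalPhenomena-4575), Sahi programme P1: **EVERY CATERPILLAR READ-ONCE PATTERN IS DIAGONALLY CERTIFIED**,
# in every position and every dimension (the certificate-level form of the caterpillar theorem)

Support file (Sahi cell, seat `prim-sahi-p1`, generation 33; `--supports stmt-CriticalPhenomena-4575`).  Pure proofs, no definitions, no `sorry`,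
standard axioms.  Vocabulary: `…SahiGridPattern{,CellForm,DiagCert}` (`Pd`, `sStarD`, `glue`, `cellOf`, `lamU`, `thetaVal`), `…CaterpillarDefs`
(`catEval`, `litVal`), the certificate tools of `…StarCertPrelim` (`diagCert_transfer`, `diagCert_empty`), `…DiagCert` (`diagCert_T/N_univ`) and the FOUR
certificate-level literal steps `…DiagCertLiteralAnd` (`{x₀≥1}∧V`, gen 28), `…DiagCertLiteralOr` (`{x₀≥1}∨V`, gen 28), `…DiagCertLiteralTwoAnd` (`{x₀=2}∧V`,
gen 33), `…DiagCertLiteralTwoOr` (`{x₀=2}∨V`, gen 33; an earlier certificate for this step is `litTwoAbsorb_cert` of `…StarCertPrelim`, gen 22).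

THE MATHEMATICS.  A DIAGONAL CERTIFICATE of an up-set `U ⊆ [3]^d` is `c : [3]^d → ℤ`, `c ≥ 0`, with (T) `Σ_{q∈W} c(q) ≤ Σ_{q∈W} λ_U(q)` for every
up-set `W` and (N) `Σ_{q∈P, r∈Q} Θ_U(q,r) ≤ Σ_{q∈P∩Q} c(q)` for all up-sets `P, Q` (`…SahiGridPatternDiagCert`).  It is STRONGER than goodness: it gives
`0 ≤ sStarD U B C` in the slot's own dimension (`sStarD_nonneg_of_diagCert`), goodness of every cylinder `U × [3]^n` (`sStarD_cylSet_nonneg_of_diagCert`),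
and it is the hypothesis under which further constructions stay certified (block-AND with a top-cube first block, `…DiagRouteTopCubeCert`, gen 31).
Generation 26 proved that every CATERPILLAR read-once pattern — threshold literals `litVal (thr i)` on distinct axes `σ i`, combined from the outside
in by `ops i ∈ {∨, ∧}` down to a seed `w ∈ {⊤, ⊥}` — is a GOOD first slot in every position (`sStarD_caterpillar_nonneg`).
**THEOREM (`exists_diagCert_caterpillar`, every `d`).**  Every caterpillar pattern, in every position `σ : Fin K ↪ Fin d`, admits a diagonal
certificate.  PROOF: the generation-26 induction verbatim with "good in every position" replaced by "certified in every position": seeds `⊤`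
(`c ≡ 2^d`) and `∅` (`c = 0`); a degenerate outer literal gives `⊤`, `∅` or the inner pattern with one more free axis (induction at the same `d`);
a genuine literal `[t ≤ x_p]`, `t ∈ {1,2}`, is one of the four certificate steps applied to the inner pattern on `[3]^{d-1}` (induction), followed by
the transfer of certificates along the axis re-indexing `0 ↦ p, 1+i ↦ p.succAbove i` (`diagCert_transfer`).  COROLLARIES: the caterpillar theorem again
(`sStarD_caterpillar_nonneg'`, now via certificates) and — new — every BLOCK-AND `S × A` of a top-cube up-set `S ⊆ {1,2}^j` with a caterpillar pattern
`A` is certified/good in every dimension through `diagCert_blockAnd_topCube` (recorded in the seat memo; the instance needs only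
`exists_diagCert_caterpillar` as input).  Nothing here asserts `PatternPos d` for `d ≥ 4`. [this work]
-/

namespace Summit.CriticalPhenomena.PercolationContinuityZ3.Theorems.SahiGridPattern

open Finset SahiGrid3
open scoped BigOperators

/-! ### The four literal steps in existential form (certificate in, certificate out) -/

section steps
variable {k : ℕ} {U' : Finset (Pd k)} {A : Finset (Pd (1 + k))}

/-- **∨-step, certificate form**: if the up-set `U' ⊆ [3]^k` has a diagonal certificate then so does `{(ξ,z) : t ≤ ξ₀ ∨ z ∈ U'}` for every
threshold `t ∈ {1,2}` (`…DiagCertLiteralOr` for `t = 1` — where no certificate of `U'` is even needed — and `…DiagCertLiteralTwoOr` for `t = 2`). [this work] -/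
theorem exists_diagCert_literalOr_step (t : Fin 3) (ht : t ≠ 0) (hU' : IsUpperSet (U' : Set (Pd k)))
    (hcert : ∃ c : Pd k → ℤ, (∀ q, 0 ≤ c q) ∧
      (∀ W : Finset (Pd k), IsUpperSet (W : Set (Pd k)) → (∑ q ∈ W, c q) ≤ ∑ q ∈ W, lamU U' q) ∧
      (∀ P Q : Finset (Pd k), IsUpperSet (P : Set (Pd k)) → IsUpperSet (Q : Set (Pd k)) →
        (∑ q ∈ P, ∑ r ∈ Q, thetaVal U' q r) ≤ ∑ q ∈ P ∩ Q, c q))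
    (hA : ∀ ξ z, glue ξ z ∈ A ↔ (t ≤ ξ 0 ∨ z ∈ U')) :
    ∃ c' : Pd (1 + k) → ℤ, (∀ x, 0 ≤ c' x) ∧
      (∀ W : Finset (Pd (1 + k)), IsUpperSet (W : Set (Pd (1 + k))) → (∑ x ∈ W, c' x) ≤ ∑ x ∈ W, lamU A x) ∧
      (∀ P Q : Finset (Pd (1 + k)), IsUpperSet (P : Set (Pd (1 + k))) → IsUpperSet (Q : Set (Pd (1 + k))) →
        (∑ x ∈ P, ∑ y ∈ Q, thetaVal A x y) ≤ ∑ x ∈ P ∩ Q, c' x) := by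
  obtain ⟨c, hc, hT, hN⟩ := hcert
  have ht12 : t = 1 ∨ t = 2 := by
    have : ∀ u : Fin 3, u ≠ 0 → u = 1 ∨ u = 2 := by decide
    exact this t ht
  rcases ht12 with rfl | rfl
  · refine ⟨fun x => if freeOf x 0 = 0 then 2 * 2 ^ k * ind U' (cellOf x) else 2 * 2 ^ k + (2 ^ k * ind U' (cellOf x) - (nuCount U' (cellOf x) : ℤ)),
      fun x => ?_, fun W hW => diagCert_literalOneOr_T hA W hW, fun P Q hP hQ => diagCert_literalOneOr_N hU' hA P Q hP hQ⟩
    show 0 ≤ (if freeOf x 0 = 0 then 2 * 2 ^ k * ind U' (cellOf x) else 2 * 2 ^ k + (2 ^ k * ind U' (cellOf x) - (nuCount U' (cellOf x) : ℤ)))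
    have h1 := ind_nonneg' U' (cellOf x)
    have h2 := nuCount_le_two_pow U' (cellOf x)
    have h3 : (0:ℤ) ≤ 2 ^ k := by positivity
    split_ifs
    · exact mul_nonneg (by positivity) h1
    · nlinarith
  · exact ⟨_, fun x => diagCert_literalTwoOr_nonneg c hc x, fun W hW => diagCert_literalTwoOr_T hA c hT W hW,
      fun P Q hP hQ => diagCert_literalTwoOr_N hU' hA c hc hN P Q hP hQ⟩

/-- **∧-step, certificate form**: if the up-set `U' ⊆ [3]^k` has a diagonal certificate then so does `{(ξ,z) : t ≤ ξ₀ ∧ z ∈ U'}` for every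
threshold `t ∈ {1,2}` (`…DiagCertLiteralAnd` for `t = 1`, `…DiagCertLiteralTwoAnd` for `t = 2`). [this work] -/
theorem exists_diagCert_literalAnd_step (t : Fin 3) (ht : t ≠ 0) (hU' : IsUpperSet (U' : Set (Pd k)))
    (hcert : ∃ c : Pd k → ℤ, (∀ q, 0 ≤ c q) ∧
      (∀ W : Finset (Pd k), IsUpperSet (W : Set (Pd k)) → (∑ q ∈ W, c q) ≤ ∑ q ∈ W, lamU U' q) ∧
      (∀ P Q : Finset (Pd k), IsUpperSet (P : Set (Pd k)) → IsUpperSet (Q : Set (Pd k)) →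
        (∑ q ∈ P, ∑ r ∈ Q, thetaVal U' q r) ≤ ∑ q ∈ P ∩ Q, c q))
    (hA : ∀ ξ z, glue ξ z ∈ A ↔ (t ≤ ξ 0 ∧ z ∈ U')) :
    ∃ c' : Pd (1 + k) → ℤ, (∀ x, 0 ≤ c' x) ∧
      (∀ W : Finset (Pd (1 + k)), IsUpperSet (W : Set (Pd (1 + k))) → (∑ x ∈ W, c' x) ≤ ∑ x ∈ W, lamU A x) ∧
      (∀ P Q : Finset (Pd (1 + k)), IsUpperSet (P : Set (Pd (1 + k))) → IsUpperSet (Q : Set (Pd (1 + k))) →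
        (∑ x ∈ P, ∑ y ∈ Q, thetaVal A x y) ≤ ∑ x ∈ P ∩ Q, c' x) := by
  obtain ⟨c, hc, hT, hN⟩ := hcert
  have ht12 : t = 1 ∨ t = 2 := by
    have : ∀ u : Fin 3, u ≠ 0 → u = 1 ∨ u = 2 := by decide
    exact this t ht
  rcases ht12 with rfl | rfl
  · refine ⟨fun x => if freeOf x 0 = 0 then (0:ℤ) else 2 * c (cellOf x), fun x => ?_,
      fun W hW => diagCert_literalOneAnd_T hA c hT W hW, fun P Q hP hQ => diagCert_literalOneAnd_N hU' hA c hc hN P Q hP hQ⟩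
    show 0 ≤ (if freeOf x 0 = 0 then (0:ℤ) else 2 * c (cellOf x))
    split_ifs
    · exact le_rfl
    · exact mul_nonneg (by norm_num) (hc _)
  · refine ⟨fun x => if freeOf x 0 = 2 then 2 * c (cellOf x) else (0:ℤ), fun x => ?_,
      fun W hW => diagCert_literalTwoAnd_T hA c hT W hW, fun P Q hP hQ => diagCert_literalTwoAnd_N hU' hA c hN P Q hP hQ⟩
    show 0 ≤ (if freeOf x 0 = 2 then 2 * c (cellOf x) else (0:ℤ))
    split_ifs
    · exact mul_nonneg (by norm_num) (hc _)
    · exact le_rfl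

end steps

/-! ### Seeds -/

/-- The whole cube `[3]^d` is certified by `c ≡ 2^d`. [this work] -/
theorem exists_diagCert_univ (d : ℕ) :
    ∃ c : Pd d → ℤ, (∀ q, 0 ≤ c q) ∧
      (∀ W : Finset (Pd d), IsUpperSet (W : Set (Pd d)) → (∑ q ∈ W, c q) ≤ ∑ q ∈ W, lamU (univ : Finset (Pd d)) q) ∧
      (∀ P Q : Finset (Pd d), IsUpperSet (P : Set (Pd d)) → IsUpperSet (Q : Set (Pd d)) →
        (∑ q ∈ P, ∑ r ∈ Q, thetaVal (univ : Finset (Pd d)) q r) ≤ ∑ q ∈ P ∩ Q, c q) :=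
  ⟨fun _ => (2:ℤ) ^ d, fun _ => by positivity, fun W _ => diagCert_T_univ W, fun P Q hP hQ => diagCert_N_univ P Q hP hQ⟩

/-- The empty pattern is certified by `c = 0`. [this work] -/
theorem exists_diagCert_empty (d : ℕ) :
    ∃ c : Pd d → ℤ, (∀ q, 0 ≤ c q) ∧
      (∀ W : Finset (Pd d), IsUpperSet (W : Set (Pd d)) → (∑ q ∈ W, c q) ≤ ∑ q ∈ W, lamU (∅ : Finset (Pd d)) q) ∧
      (∀ P Q : Finset (Pd d), IsUpperSet (P : Set (Pd d)) → IsUpperSet (Q : Set (Pd d)) →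
        (∑ q ∈ P, ∑ r ∈ Q, thetaVal (∅ : Finset (Pd d)) q r) ≤ ∑ q ∈ P ∩ Q, c q) :=
  ⟨fun _ => (0:ℤ), diagCert_empty⟩

/-! ### The certified caterpillar -/

/-- **EVERY CATERPILLAR PATTERN IS DIAGONALLY CERTIFIED** (every `d`): for a caterpillar read-once formula with threshold literals
`litVal (thr i)` placed on distinct axes `σ i` of `[3]^d` (all other axes free), the set `A` it cuts out admits `c ≥ 0` with (T) and (N). [this work] -/
theorem exists_diagCert_caterpillar : ∀ (K : ℕ) (ops : Fin K → Bool) (thr : Fin K → Option (Fin 3)) (w : Bool)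
    (d : ℕ) (σ : Fin K → Fin d), Function.Injective σ →
    ∀ A : Finset (Pd d), (∀ y : Pd d, y ∈ A ↔ catEval K ops (fun i => litVal (thr i) (y (σ i))) w = true) →
    ∃ c : Pd d → ℤ, (∀ q, 0 ≤ c q) ∧
      (∀ W : Finset (Pd d), IsUpperSet (W : Set (Pd d)) → (∑ q ∈ W, c q) ≤ ∑ q ∈ W, lamU A q) ∧
      (∀ P Q : Finset (Pd d), IsUpperSet (P : Set (Pd d)) → IsUpperSet (Q : Set (Pd d)) →
        (∑ q ∈ P, ∑ r ∈ Q, thetaVal A q r) ≤ ∑ q ∈ P ∩ Q, c q)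
  | 0 => by
      intro ops thr w d σ _ A hA
      cases w
      · have e : A = ∅ := Finset.eq_empty_of_forall_notMem fun y hy => by simpa using (hA y).1 hy
        rw [e]; exact exists_diagCert_empty d
      · have e : A = univ := Finset.eq_univ_of_forall fun y => (hA y).2 (by simp)
        rw [e]; exact exists_diagCert_univ d
  | K + 1 => by
      intro ops thr w d σ hσ A hA
      cases d with
      | zero => exact Fin.elim0 (σ 0)
      | succ d' =>
      classical
      -- the inner formula (literals `1, …, K`) and its value at a point of the big cube
      set ops' : Fin K → Bool := fun j => ops j.succ with hops'
      set thr' : Fin K → Option (Fin 3) := fun j => thr j.succ with hthr'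
      set p : Fin (d' + 1) := σ 0 with hp
      have hσ' : Function.Injective (fun j : Fin K => σ j.succ) := fun j j' h => Fin.succ_injective _ (hσ h)
      have hmemA : ∀ x : Pd (d' + 1), x ∈ A ↔ (if ops 0 = true then
          litVal (thr 0) (x p) || catEval K ops' (fun j => litVal (thr' j) (x (σ j.succ))) w
          else litVal (thr 0) (x p) && catEval K ops' (fun j => litVal (thr' j) (x (σ j.succ))) w) = true := fun x => by
        rw [hA x, catEval_succ]
      -- the inner pattern placed on the axes `σ ∘ succ` (axis `p` free) is certified, by induction
      have hinner : ∀ A₁ : Finset (Pd (d' + 1)),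
          (∀ x : Pd (d' + 1), x ∈ A₁ ↔ catEval K ops' (fun j => litVal (thr' j) (x (σ j.succ))) w = true) →
          ∃ c : Pd (d' + 1) → ℤ, (∀ q, 0 ≤ c q) ∧
            (∀ W : Finset (Pd (d' + 1)), IsUpperSet (W : Set (Pd (d' + 1))) → (∑ q ∈ W, c q) ≤ ∑ q ∈ W, lamU A₁ q) ∧
            (∀ P Q : Finset (Pd (d' + 1)), IsUpperSet (P : Set (Pd (d' + 1))) → IsUpperSet (Q : Set (Pd (d' + 1))) →
              (∑ q ∈ P, ∑ r ∈ Q, thetaVal A₁ q r) ≤ ∑ q ∈ P ∩ Q, c q) := fun A₁ hA₁ =>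
        exists_diagCert_caterpillar K ops' thr' w (d' + 1) (fun j => σ j.succ) hσ' A₁ hA₁
      -- the inner pattern on `[3]^{d'}` (axis `p` removed), certified by induction, and the axis equivalence
      have hg : ∀ j : Fin K, ∃ i : Fin d', p.succAbove i = σ j.succ := fun j =>
        Fin.exists_succAbove_eq (fun h => Fin.succ_ne_zero j (hσ (h.trans hp)))
      choose g hg using hg
      have hginj : Function.Injective g := fun j j' h => by
        have e := congrArg p.succAbove h
        rw [hg, hg] at e
        exact Fin.succ_injective _ (hσ e)
      set U' : Finset (Pd d') := univ.filter fun z : Pd d' => catEval K ops' (fun j => litVal (thr' j) (z (g j))) w = true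
        with hU'
      have hU'mem : ∀ z : Pd d', z ∈ U' ↔ catEval K ops' (fun j => litVal (thr' j) (z (g j))) w = true := fun z => by
        rw [hU', Finset.mem_filter]; simp
      have hcertU' : ∃ c : Pd d' → ℤ, (∀ q, 0 ≤ c q) ∧
          (∀ W : Finset (Pd d'), IsUpperSet (W : Set (Pd d')) → (∑ q ∈ W, c q) ≤ ∑ q ∈ W, lamU U' q) ∧
          (∀ P Q : Finset (Pd d'), IsUpperSet (P : Set (Pd d')) → IsUpperSet (Q : Set (Pd d')) →
            (∑ q ∈ P, ∑ r ∈ Q, thetaVal U' q r) ≤ ∑ q ∈ P ∩ Q, c q) :=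
        exists_diagCert_caterpillar K ops' thr' w d' g hginj U' hU'mem
      have hU'up : IsUpperSet (U' : Set (Pd d')) := by
        intro z z' hle hz
        rw [Finset.mem_coe, hU'mem] at hz ⊢
        exact catEval_mono K ops' (fun j hj => litVal_mono (hle (g j)) hj) w hz
      let ε : Fin (1 + d') ≃ Fin (d' + 1) := (finCongr (Nat.add_comm 1 d')).trans p.cycleRange.symm
      have hε0 : ε (Fin.castAdd d' (0 : Fin 1)) = p := by
        show p.cycleRange.symm (finCongr _ (Fin.castAdd d' 0)) = p
        have e : finCongr (Nat.add_comm 1 d') (Fin.castAdd d' (0 : Fin 1)) = 0 := Fin.ext (by simp)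
        rw [e, Fin.cycleRange_symm_zero]
      have hε1 : ∀ i : Fin d', ε (Fin.natAdd 1 i) = p.succAbove i := fun i => by
        show p.cycleRange.symm (finCongr _ (Fin.natAdd 1 i)) = _
        have e : finCongr (Nat.add_comm 1 d') (Fin.natAdd 1 i) = i.succ := Fin.ext (by simp)
        rw [e, Fin.cycleRange_symm_succ]
      have hhead : ∀ x : Pd (d' + 1), (x ∘ ε) (Fin.castAdd d' (0 : Fin 1)) = x p := fun x => by
        rw [Function.comp_apply, hε0]
      have hcell : ∀ x : Pd (d' + 1), cellOf (n := 1) (x ∘ ε) ∈ U' ↔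
          catEval K ops' (fun j => litVal (thr' j) (x (σ j.succ))) w = true := fun x => by
        rw [hU'mem]
        have e : (fun j => litVal (thr' j) (cellOf (n := 1) (x ∘ ε) (g j))) = fun j => litVal (thr' j) (x (σ j.succ)) := by
          funext j
          simp only [cellOf, Function.comp_apply, hε1, hg]
        rw [e]
      -- transfer of a certificate of a set `A'' ⊆ [3]^{1+d'}` along `ε`
      have htransfer : ∀ A'' : Finset (Pd (1 + d')), (∀ x : Pd (d' + 1), x ∈ A ↔ (x ∘ ε) ∈ A'') →
          (∃ c : Pd (1 + d') → ℤ, (∀ q, 0 ≤ c q) ∧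
            (∀ W : Finset (Pd (1 + d')), IsUpperSet (W : Set (Pd (1 + d'))) → (∑ q ∈ W, c q) ≤ ∑ q ∈ W, lamU A'' q) ∧
            (∀ P Q : Finset (Pd (1 + d')), IsUpperSet (P : Set (Pd (1 + d'))) → IsUpperSet (Q : Set (Pd (1 + d'))) →
              (∑ q ∈ P, ∑ r ∈ Q, thetaVal A'' q r) ≤ ∑ q ∈ P ∩ Q, c q)) →
          ∃ c : Pd (d' + 1) → ℤ, (∀ q, 0 ≤ c q) ∧
            (∀ W : Finset (Pd (d' + 1)), IsUpperSet (W : Set (Pd (d' + 1))) → (∑ q ∈ W, c q) ≤ ∑ q ∈ W, lamU A q) ∧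
            (∀ P Q : Finset (Pd (d' + 1)), IsUpperSet (P : Set (Pd (d' + 1))) → IsUpperSet (Q : Set (Pd (d' + 1))) →
              (∑ q ∈ P, ∑ r ∈ Q, thetaVal A q r) ≤ ∑ q ∈ P ∩ Q, c q) := by
        intro A'' hmem hc
        obtain ⟨c, hc0, hcT, hcN⟩ := hc
        obtain ⟨h0, hT, hN⟩ := diagCert_transfer ε hmem c hc0 hcT hcN
        exact ⟨fun x => c (x ∘ ε), h0, hT, hN⟩
      -- case analysis on the outermost literal
      rcases hthr0 : thr 0 with _ | t
      · -- never-true literal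
        by_cases h0 : ops 0 = true
        · -- `never ∨ inner` = inner (axis `p` free)
          refine hinner A fun x => ?_
          rw [hmemA x, if_pos h0, hthr0, litVal_none, Bool.false_or]
        · -- `never ∧ inner` = ∅
          have e : A = ∅ := Finset.eq_empty_of_forall_notMem fun x hx => by
            have h := (hmemA x).1 hx
            rw [if_neg h0, hthr0, litVal_none, Bool.false_and] at h
            exact Bool.false_ne_true h
          rw [e]; exact exists_diagCert_empty (d' + 1)
      · by_cases ht : t = 0
        · subst ht
          by_cases h0 : ops 0 = true
          · -- `always ∨ inner` = the whole cube
            have e : A = univ := Finset.eq_univ_of_forall fun x => by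
              rw [hmemA x, if_pos h0, hthr0, litVal_some_zero, Bool.true_or]
            rw [e]; exact exists_diagCert_univ (d' + 1)
          · -- `always ∧ inner` = inner (axis `p` free)
            refine hinner A fun x => ?_
            rw [hmemA x, if_neg h0, hthr0, litVal_some_zero, Bool.true_and]
        · -- a genuine literal `[t ≤ x_p]`, `t ∈ {1,2}`: the certificate steps, conjugated by `ε`
          by_cases h0 : ops 0 = true
          · set A'' : Finset (Pd (1 + d')) := univ.filter fun u : Pd (1 + d') =>
              t ≤ u (Fin.castAdd d' (0 : Fin 1)) ∨ cellOf (n := 1) u ∈ U' with hA''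
            have hglue : ∀ (ξ : Pd 1) (z : Pd d'), glue ξ z ∈ A'' ↔ t ≤ ξ 0 ∨ z ∈ U' := fun ξ z => by
              rw [hA'', Finset.mem_filter, glue_castAdd, cellOf_glue]; simp
            refine htransfer A'' (fun x => ?_) (exists_diagCert_literalOr_step t ht hU'up hcertU' hglue)
            rw [hmemA x, if_pos h0, hthr0, litVal_some, Bool.or_eq_true, decide_eq_true_iff, hA'', Finset.mem_filter, hhead x, hcell x]
            simp
          · set A'' : Finset (Pd (1 + d')) := univ.filter fun u : Pd (1 + d') =>
              t ≤ u (Fin.castAdd d' (0 : Fin 1)) ∧ cellOf (n := 1) u ∈ U' with hA''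
            have hglue : ∀ (ξ : Pd 1) (z : Pd d'), glue ξ z ∈ A'' ↔ t ≤ ξ 0 ∧ z ∈ U' := fun ξ z => by
              rw [hA'', Finset.mem_filter, glue_castAdd, cellOf_glue]; simp
            refine htransfer A'' (fun x => ?_) (exists_diagCert_literalAnd_step t ht hU'up hcertU' hglue)
            rw [hmemA x, if_neg h0, hthr0, litVal_some, Bool.and_eq_true, decide_eq_true_iff, hA'', Finset.mem_filter, hhead x, hcell x]
            simp

/-- **Corollary: the caterpillar theorem through certificates** — `0 ≤ sStarD A B C` for every caterpillar pattern `A` in every position and all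
up-sets `B, C` (the statement of `sStarD_caterpillar_nonneg`, generation 26, re-derived from `exists_diagCert_caterpillar`). [this work] -/
theorem sStarD_caterpillar_nonneg' (K : ℕ) (ops : Fin K → Bool) (thr : Fin K → Option (Fin 3)) (w : Bool)
    {d : ℕ} (σ : Fin K → Fin d) (hσ : Function.Injective σ) {A : Finset (Pd d)}
    (hA : ∀ y : Pd d, y ∈ A ↔ catEval K ops (fun i => litVal (thr i) (y (σ i))) w = true)
    {B C : Finset (Pd d)} (hB : IsUpperSet (B : Set (Pd d))) (hC : IsUpperSet (C : Set (Pd d))) : 0 ≤ sStarD A B C := by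
  obtain ⟨c, _, hT, hN⟩ := exists_diagCert_caterpillar K ops thr w d σ hσ A hA
  exact sStarD_nonneg_of_diagCert A c hT hN hB hC

/-- **Corollary: every cylinder over a caterpillar pattern is good in every dimension** (`A × [3]^n`, the certificate lifted by
`sStarD_cylSet_nonneg_of_diagCert`). [this work] -/
theorem sStarD_cylSet_caterpillar_nonneg (K : ℕ) (ops : Fin K → Bool) (thr : Fin K → Option (Fin 3)) (w : Bool)
    {d : ℕ} (σ : Fin K → Fin d) (hσ : Function.Injective σ) {A : Finset (Pd d)}
    (hA : ∀ y : Pd d, y ∈ A ↔ catEval K ops (fun i => litVal (thr i) (y (σ i))) w = true)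
    {n : ℕ} {B C : Finset (Pd (n + d))} (hB : IsUpperSet (B : Set (Pd (n + d)))) (hC : IsUpperSet (C : Set (Pd (n + d)))) :
    0 ≤ sStarD (cylSet A : Finset (Pd (n + d))) B C := by
  obtain ⟨c, hc, hT, hN⟩ := exists_diagCert_caterpillar K ops thr w d σ hσ A hA
  exact sStarD_cylSet_nonneg_of_diagCert A c hc hT hN hB hC

end Summit.CriticalPhenomena.PercolationContinuityZ3.Theorems.SahiGridPattern
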